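import Literature.NumberTheory.EllipticCurves.CasselsTateGeneralCase
import HarnessLib

/-!
# The first case of the Cassels–Tate pairing on `m`-fold multiples, and the reduction of its value to one place

Topic `NumberTheory/EllipticCurves`; namespace `Literature.NumberTheory.EllipticCurves`. Theorems only:
**no definition and no named fact is introduced** (D-0026). Sequel of `CasselsTateFirstCase` /
`CasselsTateGeneralCase` (Milne, *ADT* I, proof of Prop. 6.9).

For the applications of the Cassels–Tate pairing to Euler systems (McCallum 1991, §2 (1) and
Prop. 4.7: the pairing of a class `d_{M-j}(n) = p^j d_M(n)`, DIVISIBLE inside `H¹(K, E)`, with a class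
of `Ш[p^N]` supported at one prime) one needs the FIRST CASE of Milne's construction in the following
explicit form, at the level `m` with auxiliary level `m²`:

* `map_mulK_mem_selmerGroup_of_zsmul_mem`: for ANY `b₁ ∈ H¹(K, E[m²])` whose multiple `m • b₁` is a
  Selmer class at level `m²`, the class `[m]_* b₁ ∈ H¹(K, E[m])` is a Selmer class at level `m` (its
  image in every `H¹(K_v, E)` is that of `m • b₁`: `map_torsionPointsMap_map_mulK`), and
  `H¹(K, E[m]) → H¹(K, E)` sends it to the image of `m • b₁` (`torsionH1ToH1_map_mulK` of the tree);
* `FirstCaseData.exists_of_zsmul_mem`: hence first-case data `D` with `D.b₁ = b₁`, `D.b = [m]_* b₁`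
  and any prescribed Selmer `D.b'` exist — the pair `(m • b₁, b')` is in the FIRST CASE, with the global
  lift `b₁` GIVEN rather than chosen;
* `ctFirstCaseFun_zsmul_eq_value`, `ctGeneralFun_zsmul_eq_value`: the pairing of the images of
  `m • D.b₁` and `D.b'` in `Ш(E/K)` is the value `∑_v inv_v((loc_v b₁ - β_v) ∪ β'_v)` of the data;
* `FirstCaseData.localTerm_eq_zero_of_res_b₁_mem`, `FirstCaseData.localTerm_eq_zero_of_res_b'_eq_zero`:
  the local term of the data vanishes at every place `v` where `loc_v b₁` already satisfies the local
  Kummer condition at level `m²`, and at every place where `loc_v b' = 0`;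
* `FirstCaseData.value_eq_localTerm_of_forall`: so if one of the two happens at every place but `v₀`,
  the value IS the local term at `v₀` — the shape of McCallum's Prop. 4.7
  (*"`⟨d_M(n), d⟩ = ∑_{λ ∣ n} ⟨d_M(n)_λ, y_λ⟩_λ`"*) when the second class is supported at one prime of `n`;
* `exists_map_inclKD_eq_of_map_mulK_eq_zero_global`, `mem_selmerGroup_of_map_inclKD_mem`,
  `torsionH1ToH1_map_inclKD`: the Selmer lift AT LEVEL `m` of a level-`m²` Selmer class killed by
  `[m]_*` (exactness of `H¹(K, E[m]) → H¹(K, E[m²]) → H¹(K, E[m])`), used for the second argument.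

All hypotheses are those of the tree's first case (`hiso`, `hPT`) / general case (`halt`, `hPT'`); no
new input. Motivation: the order form of Kolyvagin's bound on `Ш(E/K)` (McCallum 1991, Thm. 5.4 /
Cor. 5.6), whose Cassels–Tate input is a non-vanishing statement for one such local term.

## References

* [MilneADT2006] J. S. Milne, *Arithmetic Duality Theorems*, 2nd ed. (2006), Ch. I §6, proof of
  Prop. 6.9 (pp. 78–79).
* [McCallumLMS1991] W. G. McCallum, *Kolyvagin's work on Shafarevich–Tate groups*, LMS Lecture Note
  Ser. 153 (1991), §2 (1), Prop. 4.7.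
-/

noncomputable section

open scoped Classical

universe u

namespace Literature.NumberTheory.EllipticCurves

open CategoryTheory _root_.WeierstrassCurve Field NumberField
open Literature.NumberTheory.GaloisRepresentations Literature.NumberTheory.GaloisCohomology
open Literature.NumberTheory.GaloisRepresentations.DiscreteGaloisModule (mu MuCarrier pairing)
open scoped ContRepresentation

-- Cup products need `LocallyCompactSpace Γ`; as in the tree's cup-product files, the compactness of
-- absolute Galois groups is a local instance only.
attribute [local instance] absoluteGaloisGroup_compactSpace

/-! ## `[m]_*` versus `m •`, and `ι_*`, in the cohomology of the points -/

section MulK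

variable {K : Type u} [Field K] (W : WeierstrassCurve K) (m : ℕ) [NeZero m]
variable (E : Type u) [Field E] [Algebra K E]

omit [NeZero m] in
/-- Over any `K`-field `E`: the image in `H¹(Γ_E, E(K̄_E))` of `[m]_* y ∈ H¹(Γ_E, E[m])` is `m` times
the image of `y ∈ H¹(Γ_E, E[m²])` (`E[m²] →[m] E[m] ↪ E` is `m` times `E[m²] ↪ E`; the compatibility
behind Milne's "`[m] b_{v,1} = b_v`"). [cite: MilneADT2006, Ch. I §6, proof of Prop. 6.9] -/
theorem map_torsionPointsMap_map_mulK
    (y : galoisCohomology (GaloisRep.restrictField E (W.torsionGaloisModule ((m * m : ℕ) : ℤ))) 1) :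
    galoisCohomology.map (W.torsionPointsMapIntertwining (m : ℤ) E) 1
        (galoisCohomology.map ((mulK W m m).restrictField E) 1 y) =
      (m : ℤ) • galoisCohomology.map (W.torsionPointsMapIntertwining ((m * m : ℕ) : ℤ) E) 1 y := by
  obtain ⟨ψ, rfl⟩ := oneCocycleClass_surjective _ y
  rw [galoisCohomology.map_one_oneCocycleClass, galoisCohomology.map_one_oneCocycleClass,
    galoisCohomology.map_one_oneCocycleClass]
  have key : ∀ (A B : contOneCocycles (W.localGaloisModule E).toTopRep), A = (m : ℤ) • B →
      (oneCocycleClass _ A : galoisCohomology (W.localGaloisModule E) 1) =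
        (m : ℤ) • (oneCocycleClass _ B : galoisCohomology (W.localGaloisModule E) 1) := by
    rintro A B rfl
    exact (oneCocycleClass_smul _ (m : ℤ) _).trans (Int.cast_smul_eq_zsmul ℤ (m : ℤ) _)
  refine key _ _ (Subtype.ext (ContinuousMap.ext fun σ => ?_))
  change pointsMap W E ((mulK W m m (ψ.1 σ) : geomTorsion W (m : ℤ)) : geomPoints W) =
    (m : ℤ) • pointsMap W E ((ψ.1 σ : geomTorsion W ((m * m : ℕ) : ℤ)) : geomPoints W)
  rw [coe_mulK_apply, map_zsmul]

omit [NeZero m] in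
/-- Over any `K`-field `E`: `ι_* x ∈ H¹(Γ_E, E[m²])` and `x ∈ H¹(Γ_E, E[m])` have the same image in
`H¹(Γ_E, E(K̄_E))` (`E[m] ↪ E[m²] ↪ E` is `E[m] ↪ E`; functoriality of the Kummer sequence in the
level). [cite: SilvermanAEC2009, X.§4] -/
theorem map_torsionPointsMap_map_inclKD
    (x : galoisCohomology (GaloisRep.restrictField E (W.torsionGaloisModule (m : ℤ))) 1) :
    galoisCohomology.map (W.torsionPointsMapIntertwining ((m * m : ℕ) : ℤ) E) 1
        (galoisCohomology.map ((inclKD W m m).restrictField E) 1 x) =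
      galoisCohomology.map (W.torsionPointsMapIntertwining (m : ℤ) E) 1 x := by
  obtain ⟨ψ, rfl⟩ := oneCocycleClass_surjective _ x
  rw [galoisCohomology.map_one_oneCocycleClass, galoisCohomology.map_one_oneCocycleClass,
    galoisCohomology.map_one_oneCocycleClass]
  exact congrArg _ (Subtype.ext (ContinuousMap.ext fun σ => rfl))

variable [NumberField K]

omit [NeZero m] in
/-- **`[m]_* b₁` is a Selmer class at level `m` as soon as `m • b₁` is a Selmer class at level `m²`**
(for ANY `b₁ ∈ H¹(K, E[m²])`): at every place the image of `[m]_* b₁` in `H¹(K_v, E)` is the image of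
`m • b₁`. [cite: MilneADT2006, Ch. I §6, proof of Prop. 6.9] -/
theorem map_mulK_mem_selmerGroup_of_zsmul_mem [W.IsElliptic]
    {b₁ : galoisCohomology (W.torsionGaloisModule ((m * m : ℕ) : ℤ)) 1}
    (h : (m : ℤ) • b₁ ∈ selmerGroup W ((m * m : ℕ) : ℤ)) :
    galoisCohomology.map (mulK W m m) 1 b₁ ∈ selmerGroup W (m : ℤ) := by
  refine (W.mem_selmerGroup_iff_forall_localization_mem (m : ℤ) _).mpr fun v => ?_
  have hv : galoisCohomology.res (W.torsionGaloisModule ((m * m : ℕ) : ℤ)) (Place.Completion v) 1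
      ((m : ℤ) • b₁) ∈ W.kummerLocalConditionAt ((m * m : ℕ) : ℤ) (Place.Completion v) :=
    (W.mem_selmerGroup_iff_forall_localization_mem _ _).mp h v
  change galoisCohomology.res (W.torsionGaloisModule (m : ℤ)) (Place.Completion v) 1
      (galoisCohomology.map (mulK W m m) 1 b₁) ∈ W.kummerLocalConditionAt (m : ℤ) (Place.Completion v)
  rw [WeierstrassCurve.mem_kummerLocalConditionAt_iff] at hv ⊢
  rw [map_zsmul, map_zsmul] at hv
  rw [galoisCohomology.res_map_one, map_torsionPointsMap_map_mulK]
  exact hv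

omit [NeZero m] in
/-- **A class `x ∈ H¹(K, E[m])` is a Selmer class at level `m` as soon as `ι_* x` is a Selmer class at
level `m²`** (same images in every `H¹(K_v, E)`; tree `mem_kummerLocalConditionAt_of_map_inclKD_mem`).
[cite: MilneADT2006, Ch. I §6, proof of Prop. 6.9] -/
theorem mem_selmerGroup_of_map_inclKD_mem [W.IsElliptic]
    {x : galoisCohomology (W.torsionGaloisModule (m : ℤ)) 1}
    (h : galoisCohomology.map (inclKD W m m) 1 x ∈ selmerGroup W ((m * m : ℕ) : ℤ)) :
    x ∈ selmerGroup W (m : ℤ) := by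
  refine (W.mem_selmerGroup_iff_forall_localization_mem (m : ℤ) _).mpr fun v => ?_
  have hv : galoisCohomology.res (W.torsionGaloisModule ((m * m : ℕ) : ℤ)) (Place.Completion v) 1
      (galoisCohomology.map (inclKD W m m) 1 x) ∈
        W.kummerLocalConditionAt ((m * m : ℕ) : ℤ) (Place.Completion v) :=
    (W.mem_selmerGroup_iff_forall_localization_mem _ _).mp h v
  rw [galoisCohomology.res_map_one] at hv
  exact mem_kummerLocalConditionAt_of_map_inclKD_mem (W := W) (m := m) (E := Place.Completion v) hv

omit [NumberField K] [NeZero m] in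
/-- `H¹(K, E[m]) → H¹(K, E)` sends `[m]_* b₁` to the image of `m • b₁` under `H¹(K, E[m²]) → H¹(K, E)`
(tree `torsionH1ToH1_map_mulK`, additive form). [cite: MilneADT2006, Ch. I §6, proof of Prop. 6.9] -/
theorem torsionH1ToH1_map_mulK_eq_zsmul
    (b₁ : galoisCohomology (W.torsionGaloisModule ((m * m : ℕ) : ℤ)) 1) :
    torsionH1ToH1 W (m : ℤ) (galoisCohomology.map (mulK W m m) 1 b₁) =
      torsionH1ToH1 W ((m * m : ℕ) : ℤ) ((m : ℤ) • b₁) := by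
  rw [torsionH1ToH1_map_mulK]
  exact (map_zsmul (torsionH1ToH1 W ((m * m : ℕ) : ℤ)) (m : ℤ) b₁).symm

omit [NumberField K] [NeZero m] in
/-- `H¹(K, E[m²]) → H¹(K, E)` sends `ι_* x` to the image of `x` under `H¹(K, E[m]) → H¹(K, E)`
(tree `map_torsionInclusion_one_apply`, `torsionH1ToH1_torsionH1OfDvd`). [cite: SilvermanAEC2009, X.§4] -/
theorem torsionH1ToH1_map_inclKD (x : galoisCohomology (W.torsionGaloisModule (m : ℤ)) 1) :
    torsionH1ToH1 W ((m * m : ℕ) : ℤ) (galoisCohomology.map (inclKD W m m) 1 x) =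
      torsionH1ToH1 W (m : ℤ) x := by
  rw [map_torsionInclusion_one_apply, torsionH1ToH1_torsionH1OfDvd]

omit [NumberField K] in
/-- **Exactness of `H¹(K, E[m]) →ι H¹(K, E[m²]) →[m] H¹(K, E[m])`** over `K` itself: a class of
`H¹(K, E[m²])` killed by `[m]_*` comes from `H¹(K, E[m])` (the finite Kummer sequence
`0 → E[m] → E[m²] → E[m] → 0`, tree `torsion_isSES_nat`, `IsSES.exists_map_one_eq_of_map_one_eq_zero`;
the local version over a `K`-field is the tree's `exists_map_inclKD_eq_of_map_mulK_eq_zero`).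
[cite: SerreGaloisCohomology1997, I §2.2] -/
theorem exists_map_inclKD_eq_of_map_mulK_eq_zero_global [CharZero K]
    {y : galoisCohomology (W.torsionGaloisModule ((m * m : ℕ) : ℤ)) 1}
    (hy : galoisCohomology.map (mulK W m m) 1 y = 0) :
    ∃ x : galoisCohomology (W.torsionGaloisModule (m : ℤ)) 1,
      galoisCohomology.map (inclKD W m m) 1 x = y :=
  (torsion_isSES_nat W m).exists_map_one_eq_of_map_one_eq_zero y hy

end MulK

/-! ## First-case data with a given global lift `b₁` -/

namespace FirstCaseData

variable {K : Type u} [Field K] [NumberField K] {W : WeierstrassCurve K} {m : ℕ} [NeZero m]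
variable (e : geomTorsion W ((m * m : ℕ) : ℤ) → geomTorsion W ((m * m : ℕ) : ℤ) → AlgebraicClosure K)
  (hμ : ∀ S T, e S T ^ (m * m) = 1)
  (hadd₁ : ∀ S₁ S₂ T, e (S₁ + S₂) T = e S₁ T * e S₂ T)
  (hadd₂ : ∀ S T₁ T₂, e S (T₁ + T₂) = e S T₁ * e S T₂)
  (hgal : ∀ (σ : absoluteGaloisGroup K) (S T : geomTorsion W ((m * m : ℕ) : ℤ)),
    σ • e S T = e (σ • S) (σ • T))
variable (inv : LocalInvariants K (m * m))

/-- **First-case data with a GIVEN global lift**: for any `b₁ ∈ H¹(K, E[m²])` with `m • b₁` a Selmer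
class at level `m²` and any Selmer `b'` at level `m`, there are first-case data with `b := [m]_* b₁`,
this `b₁`, and this `b'` (local lifts from `FirstCaseData.exists_of_lift`).
[cite: MilneADT2006, Ch. I §6, proof of Prop. 6.9] -/
theorem exists_of_zsmul_mem [W.IsElliptic]
    {b₁ : galoisCohomology (W.torsionGaloisModule ((m * m : ℕ) : ℤ)) 1}
    (h : (m : ℤ) • b₁ ∈ selmerGroup W ((m * m : ℕ) : ℤ))
    {b' : galoisCohomology (W.torsionGaloisModule (m : ℤ)) 1} (hb' : b' ∈ selmerGroup W (m : ℤ)) :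
    ∃ D : FirstCaseData W m,
      D.b = galoisCohomology.map (mulK W m m) 1 b₁ ∧ D.b₁ = b₁ ∧ D.b' = b' :=
  FirstCaseData.exists_of_lift (map_mulK_mem_selmerGroup_of_zsmul_mem W m h) rfl hb'

omit [NeZero m] in
/-- For ANY first-case data, the class `a ∈ Ш[m]` being paired is the image of `m • b₁` under
`H¹(K, E[m²]) → H¹(K, E)`. [cite: MilneADT2006, Ch. I §6, proof of Prop. 6.9] -/
theorem torsionH1ToH1_b_eq_zsmul (D : FirstCaseData W m) :
    torsionH1ToH1 W (m : ℤ) D.b = torsionH1ToH1 W ((m * m : ℕ) : ℤ) ((m : ℤ) • D.b₁) := by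
  rw [← D.map_b₁, torsionH1ToH1_map_mulK_eq_zsmul]

variable {e hμ hadd₁ hadd₂ hgal}
variable (hiso : ∀ (v : Place K)
    ⦃x y : galoisCohomology (GaloisRep.restrictField (Place.Completion v)
      (W.torsionGaloisModule ((m * m : ℕ) : ℤ))) 1⦄,
    x ∈ W.kummerLocalConditionAt ((m * m : ℕ) : ℤ) (Place.Completion v) →
      y ∈ W.kummerLocalConditionAt ((m * m : ℕ) : ℤ) (Place.Completion v) →
        weilLocalCup W m (Place.Completion v) e hμ hadd₁ hadd₂ hgal x y = 0)

/-! ## Vanishing of single local terms -/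

include hiso in
/-- **The local term vanishes where `loc_v b₁` is already in the local Kummer condition** at level
`m²` (all three classes `loc_v b₁, β_v, β'_v` then lie in the isotropic `𝓛_v^{(m²)}`; this is how the
terms at the places prime to `n` vanish in McCallum's Prop. 4.7). [cite: MilneADT2006, Ch. I §6, proof of Prop. 6.9]
[cite: McCallumLMS1991, §4 Prop. 4.7] -/
theorem localTerm_eq_zero_of_res_b₁_mem [W.IsElliptic] (D : FirstCaseData W m) {v : Place K}
    (hv : galoisCohomology.res (W.torsionGaloisModule ((m * m : ℕ) : ℤ)) (Place.Completion v) 1 D.b₁ ∈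
      W.kummerLocalConditionAt ((m * m : ℕ) : ℤ) (Place.Completion v)) :
    D.localTerm e hμ hadd₁ hadd₂ hgal inv v = 0 :=
  ctLocalTerm_eq_zero_of_mem (inv v) (hiso v) hv (D.β_mem v) (D.β'_mem v)

/-- **The local term vanishes where `loc_v b' = 0`**: the term does not depend on the lift `β'_v` of
`loc_v b'` (`ctLocalTerm_congr_right`), and `β'_v = 0` is a lift (this is how the terms at the primes
`q ∣ n` other than `λ` vanish in McCallum's Prop. 4.7, the second class being trivial at `q`).
[cite: MilneADT2006, Ch. I §6, proof of Prop. 6.9] [cite: McCallumLMS1991, §4 Prop. 4.7] -/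
theorem localTerm_eq_zero_of_res_b'_eq_zero (D : FirstCaseData W m) {v : Place K}
    (hv : galoisCohomology.res (W.torsionGaloisModule (m : ℤ)) (Place.Completion v) 1 D.b' = 0) :
    D.localTerm e hμ hadd₁ hadd₂ hgal inv v = 0 := by
  rw [localTerm, ctLocalTerm_congr_right (inv v) D.b₁ (β₂' := 0)
    (by rw [D.map_β, D.map_mulK_res_b₁]) (by rw [D.map_β', hv, map_zero]), ctLocalTerm, map_zero,
    map_zero]

include hiso in
/-- **Reduction of the value to a single place.** If at every place `v ≠ v₀` either `loc_v b₁` lies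
in the local Kummer condition at level `m²` or `loc_v b' = 0`, then the value of the data is its local
term at `v₀` (McCallum's Prop. 4.7 with one surviving term: *"`⟨d_M(n), d⟩ = ⟨d_M(n)_λ, y_λ⟩_λ`"*).
[cite: McCallumLMS1991, §4 Prop. 4.7] [cite: MilneADT2006, Ch. I §6, proof of Prop. 6.9] -/
theorem value_eq_localTerm_of_forall [W.IsElliptic] (D : FirstCaseData W m) (v₀ : Place K)
    (h : ∀ v : Place K, v ≠ v₀ →
      galoisCohomology.res (W.torsionGaloisModule ((m * m : ℕ) : ℤ)) (Place.Completion v) 1 D.b₁ ∈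
          W.kummerLocalConditionAt ((m * m : ℕ) : ℤ) (Place.Completion v) ∨
        galoisCohomology.res (W.torsionGaloisModule (m : ℤ)) (Place.Completion v) 1 D.b' = 0) :
    D.value e hμ hadd₁ hadd₂ hgal inv = D.localTerm e hμ hadd₁ hadd₂ hgal inv v₀ := by
  rw [← D.sum_localTerm_eq_value inv hiso (Finset.subset_insert v₀ D.badSet)]
  refine Finset.sum_eq_single_of_mem v₀ (Finset.mem_insert_self v₀ _) fun v _ hv => ?_
  rcases h v hv with h₁ | h₂
  · exact D.localTerm_eq_zero_of_res_b₁_mem inv hiso h₁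
  · exact D.localTerm_eq_zero_of_res_b'_eq_zero inv h₂

end FirstCaseData

/-! ## The pairing of `m • b₁` with `b'` is the value of the data -/

section Pairing

variable {K : Type u} [Field K] [NumberField K] {W : WeierstrassCurve K} {m : ℕ} [NeZero m]
variable {e : geomTorsion W ((m * m : ℕ) : ℤ) → geomTorsion W ((m * m : ℕ) : ℤ) → AlgebraicClosure K}
  {hμ : ∀ S T, e S T ^ (m * m) = 1}
  {hadd₁ : ∀ S₁ S₂ T, e (S₁ + S₂) T = e S₁ T * e S₂ T}
  {hadd₂ : ∀ S T₁ T₂, e S (T₁ + T₂) = e S T₁ * e S T₂}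
  {hgal : ∀ (σ : absoluteGaloisGroup K) (S T : geomTorsion W ((m * m : ℕ) : ℤ)),
    σ • e S T = e (σ • S) (σ • T)}
variable (inv : LocalInvariants K (m * m))
variable (hiso : ∀ (v : Place K)
    ⦃x y : galoisCohomology (GaloisRep.restrictField (Place.Completion v)
      (W.torsionGaloisModule ((m * m : ℕ) : ℤ))) 1⦄,
    x ∈ W.kummerLocalConditionAt ((m * m : ℕ) : ℤ) (Place.Completion v) →
      y ∈ W.kummerLocalConditionAt ((m * m : ℕ) : ℤ) (Place.Completion v) →
        weilLocalCup W m (Place.Completion v) e hμ hadd₁ hadd₂ hgal x y = 0)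
-- `hPT` / `hPT'` are the reciprocity predicates on `inv`, not named facts.
variable (hPT : inv.SumLocalTermEqZero) (halt : ∀ T, e T T = 1) (hPT' : inv.SumInvLocalizationEqZero)

include hiso hPT in
/-- **The first-case pairing of (the images in `Ш` of) `m • b₁` and `b'` is the value of the data**
(`ctFirstCaseFun_eq`, keyed on the given global lift `b₁`). [cite: MilneADT2006, Ch. I §6, proof of Prop. 6.9] -/
theorem ctFirstCaseFun_zsmul_eq_value [W.IsElliptic] (D : FirstCaseData W m) :
    ctFirstCaseFun W m e hμ hadd₁ hadd₂ hgal inv (torsionH1ToH1 W ((m * m : ℕ) : ℤ) ((m : ℤ) • D.b₁))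
        (torsionH1ToH1 W (m : ℤ) D.b') =
      D.value e hμ hadd₁ hadd₂ hgal inv := by
  rw [← D.torsionH1ToH1_b_eq_zsmul]
  exact ctFirstCaseFun_eq inv hiso hPT D

include halt hPT' in
/-- **The general-case pairing of (the images in `Ш` of) `m • b₁` and `b'` is the value of the data**
(`ctGeneralFun_eq_ctFirstCaseFun`; the isotropy at every place is the tree's theorem
`GeneralCaseData.hiso_of_fact`, from `halt`). [cite: MilneADT2006, Ch. I §6, proof of Prop. 6.9] -/
theorem ctGeneralFun_zsmul_eq_value [W.IsElliptic] (D : FirstCaseData W m) :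
    ctGeneralFun W m e hμ hadd₁ hadd₂ hgal inv (torsionH1ToH1 W ((m * m : ℕ) : ℤ) ((m : ℤ) • D.b₁))
        (torsionH1ToH1 W (m : ℤ) D.b') =
      D.value e hμ hadd₁ hadd₂ hgal inv := by
  rw [← D.torsionH1ToH1_b_eq_zsmul, ctGeneralFun_eq_ctFirstCaseFun inv halt hPT' D]
  exact ctFirstCaseFun_eq inv
    (GeneralCaseData.hiso_of_fact (W := W) (m := m) (e := e) (hμ := hμ) (hadd₁ := hadd₁)
      (hadd₂ := hadd₂) (hgal := hgal) halt)
    (LocalInvariants.sumLocalTermEqZero_of_sumInvLocalizationEqZero inv hPT') D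

include halt hPT' in
/-- **McCallum's Prop. 4.7 with one surviving term, general-case pairing.** For `b₁ ∈ H¹(K, E[m²])`
with `m • b₁ ∈ Sel^{(m²)}(E/K)`, a Selmer `b'` at level `m`, and a place `v₀` outside which, at each
place, `loc_v b₁` lies in the local Kummer condition or `loc_v b' = 0`: the Cassels–Tate pairing (general
case, values in `ℤ/m²`) of the images of `m • b₁` and `b'` equals the single local term
`inv_{v₀}((loc_{v₀} b₁ - β_{v₀}) ∪ β'_{v₀})` of any first-case data `D` with `D.b₁ = b₁`, `D.b' = b'`.
[cite: McCallumLMS1991, §4 Prop. 4.7] [cite: MilneADT2006, Ch. I §6, proof of Prop. 6.9] -/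
theorem ctGeneralFun_zsmul_eq_localTerm [W.IsElliptic] (D : FirstCaseData W m) (v₀ : Place K)
    (h : ∀ v : Place K, v ≠ v₀ →
      galoisCohomology.res (W.torsionGaloisModule ((m * m : ℕ) : ℤ)) (Place.Completion v) 1 D.b₁ ∈
          W.kummerLocalConditionAt ((m * m : ℕ) : ℤ) (Place.Completion v) ∨
        galoisCohomology.res (W.torsionGaloisModule (m : ℤ)) (Place.Completion v) 1 D.b' = 0) :
    ctGeneralFun W m e hμ hadd₁ hadd₂ hgal inv (torsionH1ToH1 W ((m * m : ℕ) : ℤ) ((m : ℤ) • D.b₁))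
        (torsionH1ToH1 W (m : ℤ) D.b') =
      D.localTerm e hμ hadd₁ hadd₂ hgal inv v₀ := by
  rw [ctGeneralFun_zsmul_eq_value inv halt hPT' D]
  exact D.value_eq_localTerm_of_forall inv
    (GeneralCaseData.hiso_of_fact (W := W) (m := m) (e := e) (hμ := hμ) (hadd₁ := hadd₁)
      (hadd₂ := hadd₂) (hgal := hgal) halt) v₀ h

end Pairing

end Literature.NumberTheory.EllipticCurves

end
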